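import Mathlib
import Literature.Analysis.FluidPDE.StretchedLayerNS

/-!
# Stub `stub_rowVorticityConstruction` (crux stmt-AnomalousDissipation-3009) — tools II:
# differentiation under the integral sign for Gaussian-tailed densities against `L¹_loc`-type kernels

Helper file (supports stmt-AnomalousDissipation-3009). The cylinder Biot–Savart law and its stream function
are KERNEL-FIRST convolutions `p ↦ ∫ k(q) • g(p − q) dμ(q)` over the period strip, with a kernel `k` that is
singular at the origin (`1/r`, `log r`) and NOT decaying at `|q₂| → ∞` (`|k₁| → 1`, `Φ ∼ |q₂|`), against a
density `g` (the vorticity `ω` and its derivatives) that is smooth, `x`-periodic — so NOT compactly supported —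
but Gaussian in `y`. Neither Mathlib's `HasCompactSupport.contDiff_convolution_left/right` nor the tree's
`contDiff_integral_smul_comp_sub` (`FluidPDE/HarmonicProbe`: kernel vanishing off a ball) covers this, so we
prove the variant that does: all derivatives fall on `g`, and the domination for `p` in a unit ball comes from
the elementary shift inequality `e^{−a(s−t)²} ≤ eᵃ e^{−(a/2)s²}` (`|t| ≤ 1`).

For a measure `μ` on `ℝ × ℝ` and a `μ`-a.e. strongly measurable kernel `k` that is GAUSSIAN-TESTABLE,
`∀ c > 0, ∀ y₀, ∫ |k(q)| e^{−c(y₀ − q₂)²} dμ < ∞` (true for the three cylinder kernels on the strip, next file):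
* `integrable_ker_smul`, `continuous_integral_ker_smul` — convergence and continuity for continuous `g` with
  `‖g(p)‖ ≤ C e^{−a p₂²}`;
* `hasFDerivAt_integral_ker_smul` — `D(∫ k • g(· − q))(p) = ∫ k(q) • Dg(p − q)` for `g ∈ C¹` with Gaussian
  bounds on `g, Dg`;
* `contDiff_integral_ker_smul` — `Cⁿ` for `g ∈ Cⁿ` with Gaussian bounds on `D^i g`, `i ≤ n` (induction on `n`
  through `contDiff_succ_iff_fderiv_apply`, as in `HarmonicProbe`);
* curried read-out for plane fields `ω x y` (`F = ℝ`): `contDiff_rowConv`, and the slice derivatives of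
  `StretchedLayerNS` pass under the integral, `dX (∫ k ω(· − q)) = ∫ k (dX ω)(· − q)`, `dY` likewise
  (`dX_rowConv`, `dY_rowConv`), via `dX = D(·)(1,0)`, `dY = D(·)(0,1)` for `C¹` fields (`dX_eq_fderiv`,
  `dY_eq_fderiv`).
Registered sub-goal proved here: `stub_rowVorticityConstruction_diffUnderIntegral` (= `contDiff_rowConv`).
All `[folklore]`.
-/

set_option linter.dupNamespace false

noncomputable section

open Real Set Filter Topology MeasureTheory
open Literature.Analysis.FluidPDE Literature.Analysis.FluidPDE.StretchedLayer

namespace Summit.AnomalousDissipation.AnomalousDissipation.Theorems.MarginalStabilityChainStretchedVortexRows.RowBiotSavart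

section DiffUnder

variable {F : Type*} [NormedAddCommGroup F] [NormedSpace ℝ F]
variable {μ : Measure (ℝ × ℝ)} {k : ℝ × ℝ → ℝ}

/-- The Gaussian shift inequality `e^{−a(s−t)²} ≤ eᵃ e^{−(a/2)s²}` for `|t| ≤ 1`, `a ≥ 0`. [folklore] -/
theorem exp_shift_le {a s t : ℝ} (ha : 0 ≤ a) (ht : |t| ≤ 1) :
    Real.exp (-a * (s - t) ^ 2) ≤ Real.exp a * Real.exp (-(a / 2) * s ^ 2) := by
  rw [← Real.exp_add]
  apply Real.exp_le_exp.2
  have h1 : s ^ 2 ≤ 2 * (s - t) ^ 2 + 2 * t ^ 2 := by nlinarith [sq_nonneg (s - 2 * t)]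
  have h2 : t ^ 2 ≤ 1 := by
    have := abs_le.1 ht
    nlinarith
  nlinarith [mul_le_mul_of_nonneg_left h1 ha, mul_le_mul_of_nonneg_left h2 ha]

omit [NormedSpace ℝ F] in
/-- A Gaussian majorant of a norm has a nonnegative constant. [folklore] -/
theorem nonneg_of_gaussBound {g : ℝ × ℝ → F} {C a : ℝ} (hb : ∀ p, ‖g p‖ ≤ C * Real.exp (-a * p.2 ^ 2)) :
    0 ≤ C := by
  have := hb 0
  simp only [Prod.snd_zero, ne_eq, OfNat.ofNat_ne_zero, not_false_eq_true, zero_pow, mul_zero,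
    Real.exp_zero, mul_one] at this
  exact (norm_nonneg _).trans this

omit [NormedSpace ℝ F] in
/-- Uniform Gaussian domination on a unit ball: if `‖g(p)‖ ≤ C e^{−a p₂²}` then for `‖p − p₀‖ ≤ 1`,
`‖g(p − q)‖ ≤ C eᵃ e^{−(a/2)(p₀.2 − q.2)²}`. [folklore] -/
theorem gaussBound_shift {g : ℝ × ℝ → F} {C a : ℝ} (ha : 0 ≤ a)
    (hb : ∀ p, ‖g p‖ ≤ C * Real.exp (-a * p.2 ^ 2)) {p₀ p : ℝ × ℝ} (hp : p ∈ Metric.closedBall p₀ 1)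
    (q : ℝ × ℝ) : ‖g (p - q)‖ ≤ C * Real.exp a * Real.exp (-(a / 2) * (p₀.2 - q.2) ^ 2) := by
  have hC := nonneg_of_gaussBound hb
  have ht : |p₀.2 - p.2| ≤ 1 := by
    rw [Metric.mem_closedBall, dist_eq_norm, Prod.norm_def] at hp
    have := (le_max_right _ _).trans hp
    rwa [Real.norm_eq_abs, Prod.snd_sub, abs_sub_comm] at this
  have h := exp_shift_le (s := p₀.2 - q.2) ha ht
  have hs : p₀.2 - q.2 - (p₀.2 - p.2) = (p - q).2 := by simp only [Prod.snd_sub]; ring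
  rw [hs] at h
  calc ‖g (p - q)‖ ≤ C * Real.exp (-a * (p - q).2 ^ 2) := hb _
    _ ≤ C * (Real.exp a * Real.exp (-(a / 2) * (p₀.2 - q.2) ^ 2)) := mul_le_mul_of_nonneg_left h hC
    _ = _ := by ring

/-- **Convergence**: `q ↦ k(q) • g(p − q)` is integrable for a Gaussian-testable kernel and a continuous
density with a Gaussian bound. [folklore] -/
theorem integrable_ker_smul (hk : AEStronglyMeasurable k μ)
    (hki : ∀ c : ℝ, 0 < c → ∀ y₀ : ℝ, Integrable (fun q => ‖k q‖ * Real.exp (-c * (y₀ - q.2) ^ 2)) μ)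
    {g : ℝ × ℝ → F} (hg : Continuous g) {C a : ℝ} (ha : 0 < a)
    (hb : ∀ p, ‖g p‖ ≤ C * Real.exp (-a * p.2 ^ 2)) (p : ℝ × ℝ) :
    Integrable (fun q => k q • g (p - q)) μ := by
  refine Integrable.mono' (((hki a ha p.2)).const_mul C)
    (hk.smul (hg.comp (continuous_const.sub continuous_id)).aestronglyMeasurable)
    (Eventually.of_forall fun q => ?_)
  rw [norm_smul]
  calc ‖k q‖ * ‖g (p - q)‖ ≤ ‖k q‖ * (C * Real.exp (-a * (p - q).2 ^ 2)) :=
        mul_le_mul_of_nonneg_left (hb _) (norm_nonneg _)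
    _ = C * (‖k q‖ * Real.exp (-a * (p.2 - q.2) ^ 2)) := by simp only [Prod.snd_sub]; ring

/-- **Continuity** of `p ↦ ∫ k(q) • g(p − q) dμ` (dominated convergence on unit balls). [folklore] -/
theorem continuous_integral_ker_smul (hk : AEStronglyMeasurable k μ)
    (hki : ∀ c : ℝ, 0 < c → ∀ y₀ : ℝ, Integrable (fun q => ‖k q‖ * Real.exp (-c * (y₀ - q.2) ^ 2)) μ)
    {g : ℝ × ℝ → F} (hg : Continuous g) {C a : ℝ} (ha : 0 < a)
    (hb : ∀ p, ‖g p‖ ≤ C * Real.exp (-a * p.2 ^ 2)) :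
    Continuous fun p => ∫ q, k q • g (p - q) ∂μ := by
  refine continuous_iff_continuousAt.2 fun p₀ => ?_
  refine continuousAt_of_dominated
    (bound := fun q => C * Real.exp a * (‖k q‖ * Real.exp (-(a / 2) * (p₀.2 - q.2) ^ 2))) ?_ ?_ ?_ ?_
  · exact Eventually.of_forall fun p =>
      hk.smul (hg.comp (continuous_const.sub continuous_id)).aestronglyMeasurable
  · filter_upwards [Metric.closedBall_mem_nhds p₀ one_pos] with p hp
    refine Eventually.of_forall fun q => ?_
    rw [norm_smul]
    calc ‖k q‖ * ‖g (p - q)‖ ≤ ‖k q‖ * (C * Real.exp a * Real.exp (-(a / 2) * (p₀.2 - q.2) ^ 2)) :=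
          mul_le_mul_of_nonneg_left (gaussBound_shift ha.le hb hp q) (norm_nonneg _)
      _ = _ := by ring
  · exact (hki (a / 2) (half_pos ha) p₀.2).const_mul _
  · exact Eventually.of_forall fun q =>
      (continuous_const.smul (hg.comp (continuous_id.sub continuous_const))).continuousAt

/-- **Differentiation under the integral sign**: for `g ∈ C¹` with Gaussian bounds on `g` and `Dg`,
`p ↦ ∫ k(q) • g(p − q) dμ` has Fréchet derivative `∫ k(q) • Dg(p − q) dμ`. [folklore] -/
theorem hasFDerivAt_integral_ker_smul (hk : AEStronglyMeasurable k μ)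
    (hki : ∀ c : ℝ, 0 < c → ∀ y₀ : ℝ, Integrable (fun q => ‖k q‖ * Real.exp (-c * (y₀ - q.2) ^ 2)) μ)
    {g : ℝ × ℝ → F} (hg : ContDiff ℝ 1 g) {C a C' a' : ℝ} (ha : 0 < a)
    (hb : ∀ p, ‖g p‖ ≤ C * Real.exp (-a * p.2 ^ 2)) (ha' : 0 < a')
    (hb' : ∀ p, ‖fderiv ℝ g p‖ ≤ C' * Real.exp (-a' * p.2 ^ 2)) (p₀ : ℝ × ℝ) :
    HasFDerivAt (fun p => ∫ q, k q • g (p - q) ∂μ) (∫ q, k q • fderiv ℝ g (p₀ - q) ∂μ) p₀ := by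
  have hgc : Continuous g := hg.continuous
  have hDg : Continuous (fderiv ℝ g) := hg.continuous_fderiv one_ne_zero
  refine hasFDerivAt_integral_of_dominated_of_fderiv_le (F' := fun p q => k q • fderiv ℝ g (p - q))
    (bound := fun q => C' * Real.exp a' * (‖k q‖ * Real.exp (-(a' / 2) * (p₀.2 - q.2) ^ 2)))
    (Metric.closedBall_mem_nhds p₀ one_pos) ?_ ?_ ?_ ?_ ?_ ?_
  · exact Eventually.of_forall fun p =>
      hk.smul (hgc.comp (continuous_const.sub continuous_id)).aestronglyMeasurable
  · exact integrable_ker_smul hk hki hgc ha hb p₀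
  · exact hk.smul (hDg.comp (continuous_const.sub continuous_id)).aestronglyMeasurable
  · refine Eventually.of_forall fun q p hp => ?_
    rw [norm_smul]
    calc ‖k q‖ * ‖fderiv ℝ g (p - q)‖
        ≤ ‖k q‖ * (C' * Real.exp a' * Real.exp (-(a' / 2) * (p₀.2 - q.2) ^ 2)) :=
          mul_le_mul_of_nonneg_left (gaussBound_shift ha'.le hb' hp q) (norm_nonneg _)
      _ = _ := by ring
  · exact (hki (a' / 2) (half_pos ha') p₀.2).const_mul _
  · refine Eventually.of_forall fun q p _ => ?_
    have h1 : HasFDerivAt (fun p : ℝ × ℝ => g (p - q)) (fderiv ℝ g (p - q)) p := by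
      have := ((hg.differentiable one_ne_zero) (p - q)).hasFDerivAt.comp p (hasFDerivAt_sub_const q)
      rwa [ContinuousLinearMap.comp_id] at this
    exact h1.const_smul (k q)

/-- The directional-derivative formula `D(∫ k • g(· − q))(p) v = ∫ k(q) • Dg(p − q) v dμ`. [folklore] -/
theorem fderiv_integral_ker_smul_apply [CompleteSpace F] (hk : AEStronglyMeasurable k μ)
    (hki : ∀ c : ℝ, 0 < c → ∀ y₀ : ℝ, Integrable (fun q => ‖k q‖ * Real.exp (-c * (y₀ - q.2) ^ 2)) μ)
    {g : ℝ × ℝ → F} (hg : ContDiff ℝ 1 g) {C a C' a' : ℝ} (ha : 0 < a)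
    (hb : ∀ p, ‖g p‖ ≤ C * Real.exp (-a * p.2 ^ 2)) (ha' : 0 < a')
    (hb' : ∀ p, ‖fderiv ℝ g p‖ ≤ C' * Real.exp (-a' * p.2 ^ 2)) (p v : ℝ × ℝ) :
    fderiv ℝ (fun p => ∫ q, k q • g (p - q) ∂μ) p v = ∫ q, k q • fderiv ℝ g (p - q) v ∂μ := by
  rw [(hasFDerivAt_integral_ker_smul hk hki hg ha hb ha' hb' p).fderiv, ContinuousLinearMap.integral_apply]
  · rfl
  · exact integrable_ker_smul hk hki (hg.continuous_fderiv one_ne_zero) ha' hb' p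

/-- Gaussian bounds on the iterated derivatives of `g` up to order `n + 1` give Gaussian bounds up to order
`n` on each directional derivative `w ↦ Dg(w) v`. [folklore] -/
theorem gaussBound_fderiv_apply {n : ℕ} {g : ℝ × ℝ → F} (hg : ContDiff ℝ (n + 1) g)
    (hB : ∀ i ≤ n + 1, ∃ C a : ℝ, 0 < a ∧ ∀ p, ‖iteratedFDeriv ℝ i g p‖ ≤ C * Real.exp (-a * p.2 ^ 2))
    (v : ℝ × ℝ) :
    ∀ i ≤ n, ∃ C a : ℝ, 0 < a ∧
      ∀ p, ‖iteratedFDeriv ℝ i (fun w => fderiv ℝ g w v) p‖ ≤ C * Real.exp (-a * p.2 ^ 2) := by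
  intro i hi
  obtain ⟨C, a, ha, hCa⟩ := hB (i + 1) (by omega)
  refine ⟨‖v‖ * C, a, ha, fun p => ?_⟩
  have hDg : ContDiff ℝ n (fderiv ℝ g) := hg.fderiv_right (by norm_cast)
  have heq : (fun w => fderiv ℝ g w v) = (ContinuousLinearMap.apply ℝ F v) ∘ (fderiv ℝ g) := by
    funext w; rfl
  rw [heq, ContinuousLinearMap.iteratedFDeriv_comp_left _ hDg.contDiffAt (by exact_mod_cast hi)]
  calc ‖(ContinuousLinearMap.apply ℝ F v).compContinuousMultilinearMap (iteratedFDeriv ℝ i (fderiv ℝ g) p)‖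
      ≤ ‖ContinuousLinearMap.apply ℝ F v‖ * ‖iteratedFDeriv ℝ i (fderiv ℝ g) p‖ :=
        ContinuousLinearMap.norm_compContinuousMultilinearMap_le _ _
    _ ≤ ‖v‖ * (C * Real.exp (-a * p.2 ^ 2)) := by
        rw [norm_iteratedFDeriv_fderiv]
        have hv : ‖ContinuousLinearMap.apply ℝ F v‖ ≤ ‖v‖ :=
          ContinuousLinearMap.opNorm_le_bound _ (norm_nonneg v) fun f => by
            rw [ContinuousLinearMap.apply_apply, mul_comm]; exact f.le_opNorm v
        exact mul_le_mul hv (hCa p) (norm_nonneg _) (norm_nonneg _)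
    _ = _ := by ring

/-- **`Cⁿ` regularity** of `p ↦ ∫ k(q) • g(p − q) dμ` for a Gaussian-testable kernel and `g ∈ Cⁿ` with
Gaussian bounds on `D^i g`, `i ≤ n`. [folklore] -/
theorem contDiff_integral_ker_smul [CompleteSpace F] (hk : AEStronglyMeasurable k μ)
    (hki : ∀ c : ℝ, 0 < c → ∀ y₀ : ℝ, Integrable (fun q => ‖k q‖ * Real.exp (-c * (y₀ - q.2) ^ 2)) μ) :
    ∀ (n : ℕ) {g : ℝ × ℝ → F}, ContDiff ℝ n g →
      (∀ i ≤ n, ∃ C a : ℝ, 0 < a ∧ ∀ p, ‖iteratedFDeriv ℝ i g p‖ ≤ C * Real.exp (-a * p.2 ^ 2)) →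
      ContDiff ℝ n fun p => ∫ q, k q • g (p - q) ∂μ := by
  intro n
  induction n with
  | zero =>
    intro g hg hB
    obtain ⟨C, a, ha, hCa⟩ := hB 0 le_rfl
    have hb : ∀ p, ‖g p‖ ≤ C * Real.exp (-a * p.2 ^ 2) := fun p => by
      simpa only [norm_iteratedFDeriv_zero] using hCa p
    exact contDiff_zero.2 (continuous_integral_ker_smul hk hki hg.continuous ha hb)
  | succ n ih =>
    intro g hg hB
    have hg1 : ContDiff ℝ 1 g := hg.of_le (by exact_mod_cast Nat.succ_le_succ (Nat.zero_le n))
    obtain ⟨C, a, ha, hCa⟩ := hB 0 (Nat.zero_le _)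
    have hb : ∀ p, ‖g p‖ ≤ C * Real.exp (-a * p.2 ^ 2) := fun p => by
      simpa only [norm_iteratedFDeriv_zero] using hCa p
    obtain ⟨C', a', ha', hCa'⟩ := hB 1 (by omega)
    have hb' : ∀ p, ‖fderiv ℝ g p‖ ≤ C' * Real.exp (-a' * p.2 ^ 2) := fun p => by
      have := hCa' p
      rwa [← norm_iteratedFDeriv_fderiv, norm_iteratedFDeriv_zero] at this
    rw [show ((n + 1 : ℕ) : WithTop ℕ∞) = (n : WithTop ℕ∞) + 1 by push_cast; rfl,
      contDiff_succ_iff_fderiv_apply]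
    refine ⟨fun p => (hasFDerivAt_integral_ker_smul hk hki hg1 ha hb ha' hb' p).differentiableAt,
      fun h => ?_, fun v => ?_⟩
    · exact absurd h (by exact_mod_cast WithTop.natCast_ne_top n)
    · have hgv : ContDiff ℝ n fun w => fderiv ℝ g w v := by
        have := (show ((n + 1 : ℕ) : WithTop ℕ∞) = (n : WithTop ℕ∞) + 1 by push_cast; rfl) ▸ hg
        exact (contDiff_succ_iff_fderiv_apply.1 this).2.2 v
      have heq : (fun p => fderiv ℝ (fun p => ∫ q, k q • g (p - q) ∂μ) p v) =
          fun p => ∫ q, k q • (fun w => fderiv ℝ g w v) (p - q) ∂μ :=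
        funext fun p => fderiv_integral_ker_smul_apply hk hki hg1 ha hb ha' hb' p v
      rw [heq]
      exact ih hgv (gaussBound_fderiv_apply hg hB v)

end DiffUnder

/-! ### Curried plane fields: slice derivatives under the integral -/

section Curried

variable {μ : Measure (ℝ × ℝ)} {k : ℝ × ℝ → ℝ}

/-- For a `C¹` plane field the slice derivative `∂ₓ` is the Fréchet derivative in the direction `(1, 0)`.
[folklore] -/
theorem dX_eq_fderiv {ω : ℝ → ℝ → ℝ} (hω : ContDiff ℝ 1 fun p : ℝ × ℝ => ω p.1 p.2) (x y : ℝ) :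
    dX ω x y = fderiv ℝ (fun p : ℝ × ℝ => ω p.1 p.2) (x, y) (1, 0) := by
  have h1 : HasFDerivAt (fun p : ℝ × ℝ => ω p.1 p.2) (fderiv ℝ (fun p : ℝ × ℝ => ω p.1 p.2) (x, y)) (x, y) :=
    ((hω.differentiable one_ne_zero) (x, y)).hasFDerivAt
  have h2 : HasDerivAt (fun s : ℝ => ((s, y) : ℝ × ℝ)) ((1 : ℝ), (0 : ℝ)) x := by
    refine (hasDerivAt_id x).prodMk (hasDerivAt_const x y) |>.congr_deriv ?_
    simp
  have h3 := h1.comp_hasDerivAt x h2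
  exact h3.deriv

/-- For a `C¹` plane field the slice derivative `∂_y` is the Fréchet derivative in the direction `(0, 1)`.
[folklore] -/
theorem dY_eq_fderiv {ω : ℝ → ℝ → ℝ} (hω : ContDiff ℝ 1 fun p : ℝ × ℝ => ω p.1 p.2) (x y : ℝ) :
    dY ω x y = fderiv ℝ (fun p : ℝ × ℝ => ω p.1 p.2) (x, y) (0, 1) := by
  have h1 : HasFDerivAt (fun p : ℝ × ℝ => ω p.1 p.2) (fderiv ℝ (fun p : ℝ × ℝ => ω p.1 p.2) (x, y)) (x, y) :=
    ((hω.differentiable one_ne_zero) (x, y)).hasFDerivAt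
  have h2 : HasDerivAt (fun s : ℝ => ((x, s) : ℝ × ℝ)) ((0 : ℝ), (1 : ℝ)) y := by
    refine (hasDerivAt_const y x).prodMk (hasDerivAt_id y) |>.congr_deriv ?_
    simp
  have h3 := h1.comp_hasDerivAt y h2
  exact h3.deriv

/-- `∂ₓ` of a `C¹` plane field, uncurried, is the directional derivative field `p ↦ D ω (p) (1,0)`. [folklore] -/
theorem dX_uncurry_eq {ω : ℝ → ℝ → ℝ} (hω : ContDiff ℝ 1 fun p : ℝ × ℝ => ω p.1 p.2) :
    (fun p : ℝ × ℝ => dX ω p.1 p.2) = fun p => fderiv ℝ (fun p : ℝ × ℝ => ω p.1 p.2) p (1, 0) := by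
  funext p; exact dX_eq_fderiv hω p.1 p.2

/-- `∂_y` of a `C¹` plane field, uncurried, is the directional derivative field `p ↦ D ω (p) (0,1)`. [folklore] -/
theorem dY_uncurry_eq {ω : ℝ → ℝ → ℝ} (hω : ContDiff ℝ 1 fun p : ℝ × ℝ => ω p.1 p.2) :
    (fun p : ℝ × ℝ => dY ω p.1 p.2) = fun p => fderiv ℝ (fun p : ℝ × ℝ => ω p.1 p.2) p (0, 1) := by
  funext p; exact dY_eq_fderiv hω p.1 p.2

/-- **`Cⁿ` regularity of the kernel-first strip convolution of a plane field**: for a Gaussian-testable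
kernel `k` and `ω ∈ Cⁿ` with Gaussian bounds on `D^i ω`, `i ≤ n`, the field
`(x, y) ↦ ∫ k(q) ω(x − q₁, y − q₂) dμ` is `Cⁿ`. [folklore] -/
theorem contDiff_rowConv (hk : AEStronglyMeasurable k μ)
    (hki : ∀ c : ℝ, 0 < c → ∀ y₀ : ℝ, Integrable (fun q => ‖k q‖ * Real.exp (-c * (y₀ - q.2) ^ 2)) μ)
    (n : ℕ) {ω : ℝ → ℝ → ℝ} (hω : ContDiff ℝ n fun p : ℝ × ℝ => ω p.1 p.2)
    (hB : ∀ i ≤ n, ∃ C a : ℝ, 0 < a ∧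
      ∀ p, ‖iteratedFDeriv ℝ i (fun p : ℝ × ℝ => ω p.1 p.2) p‖ ≤ C * Real.exp (-a * p.2 ^ 2)) :
    ContDiff ℝ n fun p : ℝ × ℝ => ∫ q, k q * ω (p.1 - q.1) (p.2 - q.2) ∂μ :=
  contDiff_integral_ker_smul hk hki n hω hB

/-- **`∂ₓ` passes under the strip convolution**: `dX (∫ k ω(· − q)) x y = ∫ k(q) (dX ω)(x − q₁, y − q₂) dμ`
for `ω ∈ C¹` with Gaussian bounds on `ω` and `Dω`. [folklore] -/
theorem dX_rowConv (hk : AEStronglyMeasurable k μ)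
    (hki : ∀ c : ℝ, 0 < c → ∀ y₀ : ℝ, Integrable (fun q => ‖k q‖ * Real.exp (-c * (y₀ - q.2) ^ 2)) μ)
    {ω : ℝ → ℝ → ℝ} (hω : ContDiff ℝ 1 fun p : ℝ × ℝ => ω p.1 p.2) {C a C' a' : ℝ} (ha : 0 < a)
    (hb : ∀ x y, |ω x y| ≤ C * Real.exp (-a * y ^ 2)) (ha' : 0 < a')
    (hb' : ∀ p, ‖fderiv ℝ (fun p : ℝ × ℝ => ω p.1 p.2) p‖ ≤ C' * Real.exp (-a' * p.2 ^ 2)) (x y : ℝ) :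
    dX (fun x y => ∫ q, k q * ω (x - q.1) (y - q.2) ∂μ) x y = ∫ q, k q * dX ω (x - q.1) (y - q.2) ∂μ := by
  have hbF : ∀ p : ℝ × ℝ, ‖(fun p : ℝ × ℝ => ω p.1 p.2) p‖ ≤ C * Real.exp (-a * p.2 ^ 2) := fun p => hb p.1 p.2
  have hC : ContDiff ℝ 1 fun p : ℝ × ℝ => ∫ q, k q * ω (p.1 - q.1) (p.2 - q.2) ∂μ := by
    refine contDiff_integral_ker_smul hk hki 1 hω fun i hi => ?_
    interval_cases i
    · exact ⟨C, a, ha, fun p => by rw [norm_iteratedFDeriv_zero]; exact hbF p⟩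
    · exact ⟨C', a', ha', fun p => by rw [← norm_iteratedFDeriv_fderiv, norm_iteratedFDeriv_zero]; exact hb' p⟩
  rw [dX_eq_fderiv hC x y]
  change fderiv ℝ (fun p : ℝ × ℝ => ∫ q, k q • (fun p : ℝ × ℝ => ω p.1 p.2) (p - q) ∂μ) (x, y) (1, 0) = _
  rw [fderiv_integral_ker_smul_apply hk hki hω ha hbF ha' hb' (x, y) (1, 0)]
  refine integral_congr_ae (Eventually.of_forall fun q => ?_)
  simp only [dX_eq_fderiv hω, smul_eq_mul]
  rfl

/-- **`∂_y` passes under the strip convolution**: `dY (∫ k ω(· − q)) x y = ∫ k(q) (dY ω)(x − q₁, y − q₂) dμ`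
for `ω ∈ C¹` with Gaussian bounds on `ω` and `Dω`. [folklore] -/
theorem dY_rowConv (hk : AEStronglyMeasurable k μ)
    (hki : ∀ c : ℝ, 0 < c → ∀ y₀ : ℝ, Integrable (fun q => ‖k q‖ * Real.exp (-c * (y₀ - q.2) ^ 2)) μ)
    {ω : ℝ → ℝ → ℝ} (hω : ContDiff ℝ 1 fun p : ℝ × ℝ => ω p.1 p.2) {C a C' a' : ℝ} (ha : 0 < a)
    (hb : ∀ x y, |ω x y| ≤ C * Real.exp (-a * y ^ 2)) (ha' : 0 < a')
    (hb' : ∀ p, ‖fderiv ℝ (fun p : ℝ × ℝ => ω p.1 p.2) p‖ ≤ C' * Real.exp (-a' * p.2 ^ 2)) (x y : ℝ) :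
    dY (fun x y => ∫ q, k q * ω (x - q.1) (y - q.2) ∂μ) x y = ∫ q, k q * dY ω (x - q.1) (y - q.2) ∂μ := by
  have hbF : ∀ p : ℝ × ℝ, ‖(fun p : ℝ × ℝ => ω p.1 p.2) p‖ ≤ C * Real.exp (-a * p.2 ^ 2) := fun p => hb p.1 p.2
  have hC : ContDiff ℝ 1 fun p : ℝ × ℝ => ∫ q, k q * ω (p.1 - q.1) (p.2 - q.2) ∂μ := by
    refine contDiff_integral_ker_smul hk hki 1 hω fun i hi => ?_
    interval_cases i
    · exact ⟨C, a, ha, fun p => by rw [norm_iteratedFDeriv_zero]; exact hbF p⟩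
    · exact ⟨C', a', ha', fun p => by rw [← norm_iteratedFDeriv_fderiv, norm_iteratedFDeriv_zero]; exact hb' p⟩
  rw [dY_eq_fderiv hC x y]
  change fderiv ℝ (fun p : ℝ × ℝ => ∫ q, k q • (fun p : ℝ × ℝ => ω p.1 p.2) (p - q) ∂μ) (x, y) (0, 1) = _
  rw [fderiv_integral_ker_smul_apply hk hki hω ha hbF ha' hb' (x, y) (0, 1)]
  refine integral_congr_ae (Eventually.of_forall fun q => ?_)
  simp only [dY_eq_fderiv hω, smul_eq_mul]
  rfl

end Curried

end RowBiotSavart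

/-- **Differentiation under the strip integral for Gaussian-tailed plane fields** (registered on
stmt-AnomalousDissipation-3009 as the helper stub `stub_rowVorticityConstruction_diffUnderIntegral` of
`stub_rowVorticityConstruction`): for any measure `μ` on `ℝ × ℝ` and any `μ`-a.e. strongly measurable kernel
`k` that is Gaussian-testable (`∫ |k(q)| e^{−c(y₀−q₂)²} dμ < ∞` for all `c > 0`, `y₀`), the kernel-first
convolution `(x, y) ↦ ∫ k(q) ω(x − q₁, y − q₂) dμ` of a `Cⁿ` field `ω` with Gaussian bounds on `D^i ω`, `i ≤ n`,
is `Cⁿ` (`RowBiotSavart.contDiff_rowConv`). [folklore] -/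
theorem stub_rowVorticityConstruction_diffUnderIntegral :
    ∀ (μ : MeasureTheory.Measure (ℝ × ℝ)) (k : ℝ × ℝ → ℝ), MeasureTheory.AEStronglyMeasurable k μ →
      (∀ c : ℝ, 0 < c → ∀ y₀ : ℝ,
        MeasureTheory.Integrable (fun q : ℝ × ℝ => ‖k q‖ * Real.exp (-c * (y₀ - q.2) ^ 2)) μ) →
      ∀ (n : ℕ) (ω : ℝ → ℝ → ℝ), ContDiff ℝ n (fun p : ℝ × ℝ => ω p.1 p.2) →
        (∀ i ≤ n, ∃ C a : ℝ, 0 < a ∧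
          ∀ p : ℝ × ℝ, ‖iteratedFDeriv ℝ i (fun p : ℝ × ℝ => ω p.1 p.2) p‖ ≤ C * Real.exp (-a * p.2 ^ 2)) →
        ContDiff ℝ n (fun p : ℝ × ℝ => ∫ q, k q * ω (p.1 - q.1) (p.2 - q.2) ∂μ) :=
  fun _ _ hk hki n _ hω hB => RowBiotSavart.contDiff_rowConv hk hki n hω hB

end Summit.AnomalousDissipation.AnomalousDissipation.Theorems.MarginalStabilityChainStretchedVortexRows

end
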